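import Literature.Computability.Complexity.GateEliminationOutput

/-!
# Gate elimination, XVII: the dimension budget — output exclusions at `dim R ≥ 2d + 1`

The one-step claim `LiYang2022_step` starts from `dim R > 2d + 2` and performs up to three
substitutions; the exclusions "the output is not a (negated) variable" used when eliminating
gates fed by constants were proved in `GateEliminationSubst.lean` / `GateEliminationOutput.lean`
under `dim R ≥ 2d + 2`. They hold under `dim R ≥ 2d + 1` by the same count (an rdq-source of
dimension `D` with `q ≤ D/2` quadratic equations contains an affine subspace of dimension
`≥ D - q ≥ ⌈D/2⌉`, and one more codimension for the coordinate), which covers the state after two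
substitutions. (After three substitutions, `dim R ≥ 2d`, the output may well be a variable on
`Sol R`; the printed cases performing three substitutions do not eliminate at the output.)
Everything is PROVED. [cite: LiYang2022, Prop. 2.4, proof of Thm. 4.1 (§4.1)]

## References

* J. Li, T. Yang, *3.1n − o(n) circuit lower bounds for explicit functions*, STOC 2022
  [LiYang2022]; full version ECCC TR21-023, Prop. 2.3/2.4, §4.1.
-/

namespace Literature.Computability.Complexity

open Finset Module

/-- `IsAffineDisperser.exists_ne_of_sol_coord` under the weaker hypothesis `2d + 1 ≤ dim R`.
[cite: LiYang2022, Prop. 2.4] -/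
theorem IsAffineDisperser.exists_ne_of_sol_coord' {n d : ℕ} {f : (Fin n → ZMod 2) → Bool}
    (hf : IsAffineDisperser f d) (R : RdqSource n) (hd : 2 * d + 1 ≤ R.dim) (j : Fin n) :
    ∃ u ∈ R.Sol, ∃ v ∈ R.Sol, u j = v j ∧ f u ≠ f v := by
  obtain ⟨A, hA, hne, hdim, hq⟩ := R.exists_affineSubspace_subset_sol
  obtain ⟨A', hA', hne', hdim', hconst⟩ := exists_le_coord_const A hne j
  obtain ⟨u, hu, v, hv, huv⟩ := hf A' (by omega) hne'
  exact ⟨u, hA (hA' hu), v, hA (hA' hv), hconst u hu v hv, huv⟩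

namespace Semicircuit

variable {n : ℕ} {C : Semicircuit n} {f : (Fin n → ZMod 2) → Bool} {R : RdqSource n} {d : ℕ}
  {k₀ : Fin C.m} {a₀ : Fin 2} {b : Bool}

/-- `exists_out_eq_gate` under `2d + 1 ≤ dim R`. [cite: LiYang2022, proof of Thm. 4.1 (§4.1)] -/
theorem exists_out_eq_gate' (hf : IsAffineDisperser f d) (hF : C.Fair) (hC : C.ComputesRestr f R)
    (hd : 2 * d + 1 ≤ R.dim) : ∃ k, C.out = .gate k := by
  cases hout : C.out with
  | gate k => exact ⟨k, rfl⟩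
  | const b =>
    exfalso
    obtain ⟨u, hu, v, hv, huv⟩ := hf.exists_ne_of_sol R (by omega)
    obtain ⟨wu, hwu, -⟩ := hF (boolOfZMod2.symm u)
    obtain ⟨wv, hwv, -⟩ := hF (boolOfZMod2.symm v)
    have h1 := hC.2 u hu wu hwu
    have h2 := hC.2 v hv wv hwv
    rw [hout] at h1 h2
    exact huv (h1.symm.trans h2)
  | var j =>
    exfalso
    obtain ⟨u, hu, v, hv, hj, huv⟩ := hf.exists_ne_of_sol_coord' R hd j
    obtain ⟨wu, hwu, -⟩ := hF (boolOfZMod2.symm u)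
    obtain ⟨wv, hwv, -⟩ := hF (boolOfZMod2.symm v)
    have h1 := hC.2 u hu wu hwu
    have h2 := hC.2 v hv wv hwv
    rw [hout] at h1 h2
    change boolOfZMod2.symm u j = f u at h1
    change boolOfZMod2.symm v j = f v at h2
    rw [Circuit.boolOfZMod2_symm_apply, hj] at h1
    rw [Circuit.boolOfZMod2_symm_apply] at h2
    exact huv (h1.symm.trans h2)

/-- `out_ne_of_live_var` under `2d + 1 ≤ dim R`. [cite: LiYang2022, proof of Thm. 4.1 (§4.1)] -/
theorem out_ne_of_live_var' (hf : IsAffineDisperser f d) (hd : 2 * d + 1 ≤ R.dim) (hF : C.Fair)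
    (hC : C.ComputesRestr f R) (h₀ : C.arg k₀ a₀ = .const b) {i : Fin n}
    (h₁ : C.arg k₀ a₀.rev = .var i) : C.out ≠ .gate k₀ := by
  intro hout
  obtain ⟨u, hu, v, hv, hij, huv⟩ := hf.exists_ne_of_sol_coord' R hd i
  have key : ∀ u ∈ R.Sol, f u = C.liveFn k₀ a₀ b (boolOfZMod2.symm u i) := by
    intro u hu
    obtain ⟨w, hw, -⟩ := hF (boolOfZMod2.symm u)
    have h1 := hC.2 u hu w hw
    rw [hout] at h1
    have h2 := hw k₀
    rw [op_eq_liveFn h₀, h₁] at h2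
    rw [← h1]
    exact h2
  have hi : boolOfZMod2.symm u i = boolOfZMod2.symm v i := by
    rw [Circuit.boolOfZMod2_symm_apply, Circuit.boolOfZMod2_symm_apply, hij]
  exact huv ((key u hu).trans (hi ▸ (key v hv).symm))

/-- `rule23_out` under `2d + 1 ≤ dim R`. [cite: LiYang2022, Lemma 3.11 (Rules 2, 3)] -/
theorem rule23_out' (hf : IsAffineDisperser f d) (hd : 2 * d + 1 ≤ R.dim) (hF : C.Fair)
    (hC : C.ComputesRestr f R) {P : Finset (Fin C.m × Fin C.m)} (hP : C.IsPacking P)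
    (h₀ : C.arg k₀ a₀ = .const b) (hself : ∀ a, C.arg k₀ a ≠ .gate k₀) (hout : C.out = .gate k₀)
    {αφ αI : ℝ} (hφ : 0 ≤ αφ) (hI : 0 ≤ αI) (αQ : ℝ) :
    ∃ (C' : Semicircuit n) (P' : Finset (Fin C'.m × Fin C'.m)), C'.Fair ∧ C'.ComputesRestr f R ∧
      C'.IsPacking P' ∧ C'.m + 1 = C.m ∧
      C'.measure αφ αI αQ P' R ≤ C.measure αφ αI αQ P R - (1 - αφ) := by
  rcases bool_fn_const_or_xor (C.liveFn k₀ a₀ b) with htriv | hdeg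
  · exact absurd hout (out_ne_of_trivialized hf (by omega) hF hC h₀ htriv)
  · cases hv : C.arg k₀ a₀.rev with
    | const b' => exact absurd hout (out_ne_of_const_const hf (by omega) hF hC h₀ hv)
    | var i => exact absurd hout (out_ne_of_live_var' hf hd hF hC h₀ hv)
    | gate k₁ =>
      cases hneg : C.liveFn k₀ a₀ b false with
      | false =>
        refine rule3_out_id hF hC hP h₀ (fun t => ?_) hself hout hφ hI αQ
        rw [hdeg, hneg, Bool.xor_false]
      | true =>
        refine rule3_out_not hF hC hP h₀ hv (fun t => ?_) hself hout hφ hI αQ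
        rw [hdeg, hneg]
        cases t <;> rfl

/-- `rule23_any` under `2d + 1 ≤ dim R`. [cite: LiYang2022, Lemma 3.11 (Rules 2, 3)] -/
theorem rule23_any' (hf : IsAffineDisperser f d) (hd : 2 * d + 1 ≤ R.dim) (hF : C.Fair)
    (hC : C.ComputesRestr f R) {P : Finset (Fin C.m × Fin C.m)} (hP : C.IsPacking P)
    (h₀ : C.arg k₀ a₀ = .const b) (hself : ∀ a, C.arg k₀ a ≠ .gate k₀)
    {αφ αI : ℝ} (hφ : 0 ≤ αφ) (hI : 0 ≤ αI) (αQ : ℝ) :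
    ∃ (C' : Semicircuit n) (P' : Finset (Fin C'.m × Fin C'.m)), C'.Fair ∧ C'.ComputesRestr f R ∧
      C'.IsPacking P' ∧ C'.m + 1 = C.m ∧
      C'.measure αφ αI αQ P' R ≤ C.measure αφ αI αQ P R - (1 - αφ) := by
  by_cases hout : C.out = .gate k₀
  · exact rule23_out' hf hd hF hC hP h₀ hself hout hφ hI αQ
  · exact C.rule23 hF hC hP h₀ hself hout hφ hI αQ

end Semicircuit

end Literature.Computability.Complexity
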